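import Summits.AtomisticToContinuum.HydrodynamicLimit.Theorems.InfluenceLocality.Negative.IgnitionStatics
import Literature.Analysis.FluidPDE.HardSphereShortTime

/-!
# `InfluenceLocality` (stmt-AtomisticToContinuum-13916) is false modulo `IgnitionTemplates`

Sorry-free conclusion of Phase 1 of the refutation line `ignition-cascade-refutation` (lead c1,
2026-08-16): `InfluenceLocality_false_of_IgnitionTemplates : IgnitionTemplates → ¬ InfluenceLocality`.

* **Relabelling** an ignition template is an ignition template (`IsIgnitionTemplate.relabel`, all
  axioms are label-blind; IGNITION transports along `IsHardSphereTrajectory.comp_perm`).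
* **Cold clusters are forecast by free flight** (`localClusterState_snd_eq_of_cold`): if the range
  cluster of `i` is pairwise separated by more than a diameter plus its speed budget over `[0, τ]`,
  the local forecast by the (explicit) Alexander cluster family keeps the velocity of `i` on
  `[0, τ]` — free flight on the good set (`Alexander.ofReal_lt_freeExitTime_of_forall_lt_norm`,
  `Alexander.flow_eq_freeFlight_of_lt`), frozen junk off it.
* **Certified badness** (`card_filter_le_badCount`): on a tolerance box, on the good set of the
  Alexander flow, every kicked particle nominally farther than `(R + 1/4)ℓ` from the intruder is bad
  at range `R` — its forecast keeps its velocity, its true velocity changes (IGNITION axiom).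
* **Assembly** through the landed kill criterion `not_influenceLocality_of_witness`
  (`Negative/KillCriterion.lean`): `(a, θ, u₀) = (1, 1, 0)`, `δ = 1`, `lam = 2(|C| + κ + 2)`; for every
  range `R` and threshold `N₀` an ignition template at an admissible `N ≥ 4c₀(R + 5/4)³`, the
  Alexander flows, and the witness event `symBox ∩ good`: `#bad ≥ (N+1)/2` there (packing axiom) and
  its mass is `≥ e^{-(C+κ)(N+1)} > e^{(N+1) − lam (N+1)/2}`.

This is a NEGATIVE LEMMA (`¬ crux` modulo the constructible hypothesis `IgnitionTemplates` of
`Negative/IgnitionTemplates.lean`); it settles nothing by itself. Phase 2 of the line constructs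
the templates (designed express-octree collision cascades in a cold lattice gas).
-/

namespace Summit.AtomisticToContinuum.HydrodynamicLimit.Theorems.InfluenceLocality.Negative

open MeasureTheory Set
open scoped Classical ENNReal
open Literature.Analysis.FluidPDE Literature.MathematicalPhysics.KineticTheory
open Summit.AtomisticToContinuum.HydrodynamicLimit.Theses.AntiMazurCoboundaries (InfluenceLocality)

noncomputable section

/-! ## Relabelling a template -/

/-- Membership in a relabelled box. -/
theorem mem_templateBox_relabel {n : ℕ} (p : Fin n → T3) (w : Fin n → V3) (rx rv : Fin n → ℝ)
    (π : Equiv.Perm (Fin n)) (z : Config n (Fin 3) T3) :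
    z ∈ templateBox (p ∘ π.symm) (w ∘ π.symm) (rx ∘ π.symm) (rv ∘ π.symm) ↔
      (z ∘ π : Config n (Fin 3) T3) ∈ templateBox p w rx rv := by
  simp only [templateBox, Set.mem_setOf_eq, Function.comp_apply]
  constructor
  · intro h a
    simpa using h (π a)
  · intro h i
    simpa using h (π.symm i)

/-- Relabelled filters have the same cardinality. -/
theorem card_filter_relabel {n : ℕ} (K : Finset (Fin n)) (π : Equiv.Perm (Fin n))
    (P : Fin n → Prop) [DecidablePred P] :
    ((K.map π.toEmbedding).filter fun i => P (π.symm i)).card = (K.filter P).card := by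
  rw [Finset.filter_map, Finset.card_map]
  congr 1
  exact Finset.filter_congr fun a _ => by simp

/-- **Relabelling an ignition template gives an ignition template** (all axioms are label-blind;
the ignition axiom transports along `IsHardSphereTrajectory.comp_perm`). -/
theorem IsIgnitionTemplate.relabel {σ T vc C c₀ : ℝ} {N : ℕ} {p : Fin (N + 1) → T3}
    {w : Fin (N + 1) → V3} {rx rv : Fin (N + 1) → ℝ} {src : Fin (N + 1)}
    {K : Finset (Fin (N + 1))} (h : IsIgnitionTemplate σ T vc C c₀ N p w rx rv src K)
    (π : Equiv.Perm (Fin (N + 1))) :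
    IsIgnitionTemplate σ T vc C c₀ N (p ∘ π.symm) (w ∘ π.symm) (rx ∘ π.symm) (rv ∘ π.symm)
      (π src) (K.map π.toEmbedding) where
  rx_pos i := h.rx_pos _
  rx_le i := h.rx_le _
  rv_pos i := h.rv_pos _
  rv_le i := h.rv_le _
  vc_nonneg := h.vc_nonneg
  cold i hi := h.cold _ fun h' => hi (by rw [← h', Equiv.apply_symm_apply])
  sep i j hij := h.sep _ _ (π.symm.injective.ne hij)
  cost := by
    have := h.cost
    calc ∑ i, (‖(w ∘ π.symm) i‖ ^ 2 - Real.log (((N + 1 : ℕ) : ℝ) * (rx ∘ π.symm) i ^ 3) -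
          Real.log ((rv ∘ π.symm) i ^ 3))
        = ∑ i, (‖w i‖ ^ 2 - Real.log (((N + 1 : ℕ) : ℝ) * rx i ^ 3) - Real.log (rv i ^ 3)) :=
          Equiv.sum_comp π.symm (fun i => ‖w i‖ ^ 2 - Real.log (((N + 1 : ℕ) : ℝ) * rx i ^ 3) -
            Real.log (rv i ^ 3))
      _ ≤ C * (N + 1) := this
  packing D hD := by
    have hc : (Finset.univ.filter fun i =>
        Torus.euclidDist ((p ∘ π.symm) i) ((p ∘ π.symm) (π src)) ≤ D * ell N).card =
        (Finset.univ.filter fun i => Torus.euclidDist (p i) (p src) ≤ D * ell N).card := by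
      have := card_filter_relabel (Finset.univ : Finset (Fin (N + 1))) π
        (fun i => Torus.euclidDist (p i) (p src) ≤ D * ell N)
      rw [Finset.map_univ_equiv] at this
      simpa only [Function.comp_apply, Equiv.symm_apply_apply] using this
    rw [hc]
    exact h.packing D hD
  src_notMem := by
    rw [Finset.mem_map_equiv, Equiv.symm_apply_apply]
    exact h.src_notMem
  card_K := by
    rw [Finset.card_map]
    exact h.card_K
  ignition z hz γ hγ hγ0 i hi := by
    rw [Finset.mem_map] at hi
    obtain ⟨a, ha, rfl⟩ := hi
    have hz' : (z ∘ π : Config (N + 1) (Fin 3) T3) ∈ templateBox p w rx rv :=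
      (mem_templateBox_relabel p w rx rv π z).1 hz
    obtain ⟨t, ht, hne⟩ := h.ignition (z ∘ π) hz' (fun t => (γ t ∘ π : Config (N + 1) (Fin 3) T3))
      (hγ.comp_perm π) (by simp [hγ0]) a ha
    exact ⟨t, ht, hne⟩

/-! ## Cold, separated clusters are forecast by free flight -/

/-- **Cold-cluster forecast.** If the range cluster of `i` is pairwise separated by more than a
diameter plus its own speed budget over `[0, τ]`, then the local forecast of `i` by the Alexander
cluster family keeps the velocity of `i` on `[0, τ]` (free flight on the good set, frozen junk off
it). -/
theorem localClusterState_snd_eq_of_cold {σ : ℝ} {N : ℕ} (hε : 0 < hsDiameter σ N)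
    (hε' : hsDiameter σ N < 2⁻¹) {τ : ℝ} (hτ : 0 ≤ τ) {r : ℝ} {z : Config (N + 1) (Fin 3) T3}
    {i : Fin (N + 1)}
    (hsep : ∀ j ∈ rangeCluster (Torus.geometry (Fin 3)) r z i,
      ∀ k ∈ rangeCluster (Torus.geometry (Fin 3)) r z i, j ≠ k →
      hsDiameter σ N + τ * (‖(z j).2‖ + ‖(z k).2‖) < Torus.euclidDist (z j).1 (z k).1)
    {t : ℝ} (ht : t ∈ Set.Icc 0 τ) :
    (localClusterState (fun k => alexanderFlow hε hε' k) r t z i).2 = (z i).2 := by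
  unfold localClusterState
  set S := rangeCluster (Torus.geometry (Fin 3)) r z i with hS
  set m := clusterIndex S i (self_mem_rangeCluster (Torus.geometry (Fin 3)) r z i) with hm
  by_cases hg : Config.restrictTo S z ∈ ((fun k => alexanderFlow hε hε' k) S.card).good
  · rw [clusterStateIn_of_mem_good _ m t hg]
    change (Alexander.flow (Torus.geometry (Fin 3)) (hsDiameter σ N) t (Config.restrictTo S z) m).2
      = (z i).2
    have key : ENNReal.ofReal τ <
        Alexander.freeExitTime (Torus.geometry (Fin 3)) (hsDiameter σ N) (Config.restrictTo S z) := by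
      refine Alexander.ofReal_lt_freeExitTime_of_forall_lt_norm hε' hτ fun s hs k l hkl => ?_
      rw [Torus.norm_geometry_sepVec]
      simp only [freeFlight_apply, Config.restrictTo_apply, Torus.geometry_translate]
      set j := S.orderEmbOfFin rfl k
      set j' := S.orderEmbOfFin rfl l
      have hj : j ∈ S := S.orderEmbOfFin_mem rfl k
      have hj' : j' ∈ S := S.orderEmbOfFin_mem rfl l
      have hjj' : j ≠ j' := fun h => hkl ((S.orderEmbOfFin rfl).injective h)
      have h1 := Torus.euclidDist_le_euclidDist_translate (z j).1 (z j').1 (s • (z j).2) (s • (z j').2)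
      have h2 : ‖s • (z j).2 - s • (z j').2‖ ≤ τ * (‖(z j).2‖ + ‖(z j').2‖) := by
        calc ‖s • (z j).2 - s • (z j').2‖ ≤ ‖s • (z j).2‖ + ‖s • (z j').2‖ := norm_sub_le _ _
          _ = s * (‖(z j).2‖ + ‖(z j').2‖) := by
              rw [norm_smul, norm_smul, Real.norm_eq_abs, abs_of_nonneg hs.1]; ring
          _ ≤ τ * (‖(z j).2‖ + ‖(z j').2‖) := by
              exact mul_le_mul_of_nonneg_right hs.2 (by positivity)
      linarith [hsep j hj j' hj' hjj']
    rw [Alexander.flow_eq_freeFlight_of_lt ht.1 ((ENNReal.ofReal_le_ofReal ht.2).trans_lt key)]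
    simp [freeFlight_apply, hm]
  · rw [clusterStateIn_of_not_mem_good _ m t hg]
    simp [hm]

/-! ## Badness on the box -/

/-- **Certified badness.** On a tolerance box of an ignition template, on the good set of the
Alexander flow, every kicked particle whose nominal position is farther than `(R + 1/4) ℓ` from
the intruder is bad at range `R`: its forecast keeps its velocity (cold separated cluster), its
true velocity changes. -/
theorem card_filter_le_badCount {σ T vc C c₀ : ℝ} {N : ℕ} {p : Fin (N + 1) → T3}
    {w : Fin (N + 1) → V3} {rx rv : Fin (N + 1) → ℝ} {src : Fin (N + 1)}
    {K : Finset (Fin (N + 1))} (h : IsIgnitionTemplate σ T vc C c₀ N p w rx rv src K)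
    (hT : 0 ≤ T) (hε : 0 < hsDiameter σ N) (hε' : hsDiameter σ N < 2⁻¹) (R : ℝ)
    {z : Config (N + 1) (Fin 3) T3} (hz : z ∈ templateBox p w rx rv)
    (hzg : z ∈ (alexanderFlow hε hε' (N + 1)).good) :
    (K.filter fun i => (R + 1 / 4) * ell N < Torus.euclidDist (p i) (p src)).card ≤
      badCount σ T R N (alexanderFlow hε hε' (N + 1)) (fun k => alexanderFlow hε hε' k) z := by
  unfold badCount
  refine Finset.card_le_card fun i hi => ?_
  rw [Finset.mem_filter] at hi ⊢
  obtain ⟨hiK, hfar⟩ := hi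
  refine ⟨Finset.mem_univ _, ?_⟩
  have hℓ : 0 < ell N := Real.rpow_pos_of_pos (by positivity) _
  have hτ : 0 ≤ T * ell N := mul_nonneg hT hℓ.le
  set Φ := alexanderFlow hε hε' (N + 1)
  -- truth: the velocity of `i` changes
  obtain ⟨t, ht, hne⟩ := h.ignition z hz (fun t => Φ.flow t z) (Φ.isTrajectory z hzg)
    (Φ.flow_zero z hzg) i hiK
  refine ⟨t, ht, fun heq => hne ?_⟩
  rw [heq]
  -- forecast: the velocity of `i` is kept
  refine localClusterState_snd_eq_of_cold hε hε' hτ (fun j hj k hk hjk => ?_) ht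
  -- members of the cluster are cold …
  have hspeed : ∀ j, j ≠ src → ‖(z j).2‖ ≤ vc := by
    intro j hj
    have hb := (hz j).2
    calc ‖(z j).2‖ = ‖((z j).2 - w j) + w j‖ := by rw [sub_add_cancel]
      _ ≤ ‖(z j).2 - w j‖ + ‖w j‖ := norm_add_le _ _
      _ ≤ rv j + ‖w j‖ := by linarith
      _ ≤ vc := by linarith [h.cold j hj]
  have hsrc : src ∉ rangeCluster (Torus.geometry (Fin 3)) (R * ell N) z i := by
    intro hmem
    rcases mem_rangeCluster_torus.1 hmem with hsi | hdist
    · exact h.src_notMem (hsi ▸ hiK)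
    · have h1 := euclidDist_sub_sub_le_T3 (z i).1 (z src).1 (p i) (p src)
      have h2 := (hz i).1
      have h3 := (hz src).1
      have h4 := h.rx_le i
      have h5 := h.rx_le src
      nlinarith
  have hjs : j ≠ src := fun h' => hsrc (h' ▸ hj)
  have hks : k ≠ src := fun h' => hsrc (h' ▸ hk)
  -- … and separated
  have h1 := euclidDist_sub_sub_le_T3 (z j).1 (z k).1 (p j) (p k)
  have h2 := (hz j).1
  have h3 := (hz k).1
  have h4 := h.sep j k hjk
  have h5 := hspeed j hjs
  have h6 := hspeed k hks
  have h7 : T * ell N * (‖(z j).2‖ + ‖(z k).2‖) ≤ 2 * vc * (T * ell N) := by nlinarith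
  linarith

/-! ## The refutation modulo `IgnitionTemplates` -/

/-- **`IgnitionTemplates → ¬ InfluenceLocality`.** With `(a, θ, u₀) = (1, 1, 0)`, `δ = 1` and
`lam = 2(|C| + κ + 2)`: for every range `R` and threshold `N₀`, an ignition template at a large
admissible `N`, the Alexander flows, and the witness event `symBox ∩ good` carry `#bad ≥ (N+1)/2`
at Gibbs mass `≥ e^{-(C+κ)(N+1)} > e^{(N+1) − lam (N+1)/2}` — the kill criterion
`not_influenceLocality_of_witness` applies. -/
theorem InfluenceLocality_false_of_IgnitionTemplates (hIT : IgnitionTemplates) :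
    ¬ InfluenceLocality := by
  refine not_influenceLocality_of_witness ⟨1, 1, 0, one_pos, one_pos, fun σ₀ hσ₀ => ?_⟩
  obtain ⟨σ, hσ, hσlt, T, vc, C, c₀, hT, hH⟩ := hIT (min σ₀ 2⁻¹) (lt_min hσ₀ (by norm_num))
  have hσ₀' : σ < σ₀ := hσlt.trans_le (min_le_left _ _)
  have hσ2 : σ < 2⁻¹ := hσlt.trans_le (min_le_right _ _)
  set lam : ℝ := 2 * (|C| + costKappa + 2) with hlam
  have hlam0 : 0 < lam := by have := costKappa_pos; positivity
  refine ⟨σ, hσ, hσ₀', T, lam, 1, hT, hlam0, one_pos, fun R hR N₀ => ?_⟩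
  -- a large admissible particle number
  set N₁ : ℕ := ⌈4 * max c₀ 0 * (R + 5 / 4) ^ 3⌉₊ with hN₁
  obtain ⟨N, hN, p, w, rx, rv, src, K, hK⟩ := hH (max N₀ N₁)
  have hN₀ : N₀ ≤ N := (le_max_left _ _).trans hN
  have hNN₁ : (N₁ : ℝ) ≤ N := by exact_mod_cast (le_max_right _ _).trans hN
  have hε : 0 < hsDiameter σ N := (hsDiameter_pos_le hσ N).1
  have hε' : hsDiameter σ N < 2⁻¹ := (hsDiameter_pos_le hσ N).2.trans_lt hσ2
  have hℓ : 0 < ell N := Real.rpow_pos_of_pos (by positivity) _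
  set Φ : Flow σ N := alexanderFlow hε hε' (N + 1)
  set Ψ : ClusterFlows σ N := fun k => alexanderFlow hε hε' k
  set far : Fin (N + 1) → Prop := fun i => (R + 1 / 4) * ell N < Torus.euclidDist (p i) (p src)
  set m : ℕ := (K.filter far).card with hm_def
  refine ⟨N, hN₀, Φ, Ψ, symBox p w rx rv ∩ Φ.good, m,
    (measurableSet_symBox p w rx rv).inter Φ.measurableSet_good, ?_, ?_⟩
  · -- `#bad ≥ m` on the witness event
    rintro z ⟨hz, hzg⟩
    simp only [symBox, Set.mem_iUnion] at hz
    obtain ⟨π, hzπ⟩ := hz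
    have hb := card_filter_le_badCount (hK.relabel π) hT.le hε hε' R hzπ hzg
    have hc : ((K.map π.toEmbedding).filter fun i =>
        (R + 1 / 4) * ell N < Torus.euclidDist ((p ∘ π.symm) i) ((p ∘ π.symm) (π src))).card = m := by
      have := card_filter_relabel K π far
      simpa only [far, Function.comp_apply, Equiv.symm_apply_apply] using this
    rw [hc] at hb
    exact hb
  · -- the mass
    have hrx2 : ∀ i, rx i < 1 / 2 := fun i => by
      have h1 := hK.rx_le i
      have h2 : ell N ≤ 1 := Real.rpow_le_one_of_one_le_of_nonpos
        (by exact_mod_cast Nat.succ_le_succ (Nat.zero_le N)) (by norm_num)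
      linarith
    have hsep' : ∀ i j, i ≠ j → hsDiameter σ N ≤ Torus.euclidDist (p i) (p j) - rx i - rx j := by
      intro i j hij
      have h1 := hK.sep i j hij
      have h2 : 0 ≤ 2 * vc * (T * ell N) := by
        have := hK.vc_nonneg; have := hT.le; positivity
      linarith
    have hσhalf : σ ≤ 1 / 2 := by rw [one_div]; exact hσ2.le
    have hmass := gibbs_symBox_ge hσhalf Φ (w := w) (fun i => (hK.rx_pos i).le) hrx2
      (fun i => (hK.rv_pos i).le) hsep' hε
    have hexp := exp_le_factorial_mul_prod_boxWeight hK.rx_pos hK.rv_pos hK.rv_le hK.cost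
    rw [measure_inter_conull (gibbs_compl_good σ 1 1 0 N Φ)]
    refine lt_of_lt_of_le ?_ (le_trans (ENNReal.ofReal_le_ofReal hexp) hmass)
    rw [ENNReal.ofReal_lt_ofReal_iff (Real.exp_pos _), Real.exp_lt_exp]
    -- arithmetic: `(N+1) − lam·m < −(C+κ)(N+1)` from `m ≥ (N+1)/2`
    have hm2 : ((N : ℝ) + 1) / 2 ≤ m := by
      have hsplit := Finset.card_filter_add_card_filter_not (s := K) far
      have hnot : ((K.filter fun i => ¬ far i).card : ℝ) ≤ c₀ * (R + 1 / 4 + 1) ^ 3 := by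
        refine le_trans ?_ (hK.packing (R + 1 / 4) (by linarith))
        exact_mod_cast Finset.card_le_card fun i hi => by
          rw [Finset.mem_filter] at hi ⊢
          exact ⟨Finset.mem_univ _, not_lt.1 hi.2⟩
      have hKc : (3 : ℝ) * (N + 1) ≤ 4 * K.card := by exact_mod_cast hK.card_K
      have hsplit' : ((K.filter far).card : ℝ) + (K.filter fun i => ¬ far i).card = K.card := by
        exact_mod_cast hsplit
      have hc0 : c₀ * (R + 1 / 4 + 1) ^ 3 ≤ max c₀ 0 * (R + 5 / 4) ^ 3 := by
        rw [show R + 1 / 4 + 1 = R + 5 / 4 by ring]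
        exact mul_le_mul_of_nonneg_right (le_max_left _ _) (by positivity)
      have hN₁' : 4 * max c₀ 0 * (R + 5 / 4) ^ 3 ≤ N₁ := Nat.le_ceil _
      rw [hm_def]
      linarith
    have hCabs : C ≤ |C| := le_abs_self C
    have hκ := costKappa_pos
    have hN1 : (0 : ℝ) < N + 1 := by positivity
    rw [hlam]
    nlinarith


end

end Summit.AtomisticToContinuum.HydrodynamicLimit.Theorems.InfluenceLocality.Negative
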